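import Literature.MathematicalPhysics.QuantumFieldTheory.Balaban1983to89.Node00.RateRecordW1Maps
import Literature.MathematicalPhysics.QuantumFieldTheory.Balaban1983to89.Node00.Sect2RegionGeometry
import Literature.MathematicalPhysics.QuantumFieldTheory.Balaban1983to89.T4LevelShift
import Literature.MathematicalPhysics.QuantumFieldTheory.Balaban1983to89.B5AveragingLocalityV1
import Summits.QuantumFields.YangMills.Theorems.BalabanUVNodesN18CondIKRow
import Summits.QuantumFields.YangMills.Theorems.BalabanUVNodesN18CondILevelNesting

/-!
# BalabanUVNodes ∕ node N18 = NE5 — closure-ledger item (iii): THE TWO-RUN DICTIONARY OF THE (I.1.12) CUBES AND OF THE LOCALIZATION DOMAINS UNDER THE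
# TRANSPORT OF RECORD — a run-B fine site lies in the `L·s`-cube of index `a` iff its block, read on run A, lies in the `s`-cube of index `a`; the sites of the
# paired domain `π(j, Y)` are the block-preimage of the sites of `Y`; the feeding bonds ∕ stencils of a run-A cube-region are bonds ∕ stencils of the run-B one
# (Track A, DAG node N18 = `T4OutputRate.NE5` :211; cluster K4 «SpineRates», item K3⁷ `SpineGivenEndpointR13SepCoPH`; module 19c of seat pub-ymgap-dag-n18-d, s2)

HONEST FRAMING.  Count-neutral kernel bookkeeping (`--supports stmt-QuantumFields-20544 --as helper`); pure lattice geometry, PROVED.  NE5 is NOT PRINTED and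
NOT proved; N18 is NOT discharged; nothing of the transport clause `hT` at `spaceI` is discharged here.

WHY.  The transport clause of the admissible reading at the table of record (`RateRecordW1MapsAdm.LevelPairing.ofRecordAdm … T₀ hT₀`, `sp = spaceI`; this seat's
closure ledger (iii)) compares run B = `F.P (k+1)` read at level `j+1`, domain `π(j, Y) = pairOfRecord F M k ⟨j, Y⟩` ([I] (0.24)–(0.25): run B's creation step
`j+1` has run A's step-`j` spacing) with run A = `F.P k` at level `j`, domain `Y`, through the transport of record `T₀ = transportRaw F k (avOfRecord F N (k+1) 0)` =
ONE (0.4) block averaging on run B's finest lattice followed by the level identification `T4LevelShift.siteShift ∕ fieldShift` along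
`(F.P k).sitesPerDir 0 = (F.P (k+1)).sitesPerDir 1` (`sitesPerDir_ladder`).  Every LOCAL step of that clause — the (1.11) half per region
(`BlockAveragingPlaquetteBoundLocal`), the (1.12) half per cube (the lens's (β), with this seat's K-row `…N18CondIKRow` whose hypotheses are on the FEEDING bonds
∕ sites) — must know that the data of run B on the cube-region `□_B ∩ Y_B` feed the letters of run A on `□_A ∩ Y_A`.  Module 13 (`…N18AdmTransportPlaqSmall`)
never needed this because its plaquette-small tables are global; at `spaceI` the (I.1.12) cubes `Sect2.cubesI M j Y` (side `L^{j+1}M` fine sites of the run,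
`cubeEnl P (side L M (j+1)) a 0`, origin-anchored `cubeExt`) and the domain sites `Sect2.domSites` are run-relative.  This file is the dictionary.

WHAT (all along `ladder F k : (F.P k).sitesPerDir 0 = (F.P (k+1)).sitesPerDir 1`; «bmap» `x ↦ (siteShift (ladder F k)).symm (blockOf x)` = the block of a run-B fine
site read as a run-A fine site — written out, no `def`).
* §1 `natCast_val_div_eq_intCast_ediv` (`(z mod S₁L) div L ≡ z div L (mod S₁)`), ★ `blockOf_cover` (`blockOf (cover_B z) = siteShift (cover_A ⌊z∕L⌋)` for EVERY
  `z ∈ ℤ⁴` — no wrap hypothesis), `cover_eq_cover_iff`, `ediv_mem_cubeExt_of_mem` ∕ `mem_cubeExt_mul_of_ediv_mem` (floor division by `L` maps the `L·s`-cube onto the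
  `s`-cube, collars `n·(L·s) ↦ n·s`), ★ `mem_cubeEnl_succ_iff` (`x ∈ cubeEnl (F.P (k+1)) (L·s) a n ↔ bmap x ∈ cubeEnl (F.P k) s a n`, every `s, a, n`),
  `cubeEnl_succ_eq_preimage`.
* §2 `exists_mem_castDom_tsys_iff` ∕ `exists_mem_pairOfRecord_iff` (the cube indices of `π(j, Y)` are those of `Y`), ★ `mem_domSites_pairOfRecord_iff` ∕
  `domSites_pairOfRecord_eq_preimage` (`domSites_B (π(j,Y)) = bmap ⁻¹' domSites_A Y`), `cubeInter_succ_eq_preimage` (`□_B ∩ Y_B = bmap ⁻¹' (□_A ∩ Y_A)` for the cube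
  of `cubesI M (j+1)` over the cube of `cubesI M j` of the same index, `side L M (j+2) = L · side L M (j+1)`), `cubeIndices_succ_eq` (`⌈LS∕(Ls)⌉ = ⌈S∕s⌉`), `bmap_emb`,
  `preimage_bmap_nonempty_iff`, ★ `regionOfSet_preimage_mem_cubesI_succ` (the run-B region over a run-A (1.12) cube-region IS a member of
  `cubesI M (j+1) (domSites π(j,Y))` — run B's (1.12) supplies a local gauge on exactly the fine sites feeding `□_A ∩ Y_A`).
* §3 region faces over a GENERAL run-A site set `Z` and its block-preimage `bmap ⁻¹' Z` (the LOCALITY hypotheses of 19a's `…_of_forall_run` lemmas, discharged from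
  membership in `regionOfSet (F.P k) Z`): `blockOf_runSite_or` (a straight run of `≤ L` steps moves the block by at most one coarse step), `blockOf_runSite_runSite_mem`,
  `blockSite_mem_preimage`, ★ `runBond_blockSite_mem_bonds_preimage` (the `L^{d+1}` feeding bonds of a coarse bond of `regionOfSet Z` are bonds of
  `regionOfSet (bmap ⁻¹' Z)`), ★ `feedSite_mem_dpairs_preimage` (the `L^{d+2}` feeding stencils of a coarse stencil of `regionOfSet Z` are stencils of
  `regionOfSet (bmap ⁻¹' Z)`).

WHAT THIS IS NOT.  Not the transport clause, not (β), not an estimate; finite tori — not continuum ∕ OS ∕ mass gap ∕ Clay.  0 `def`, 0 `sorry`, standard axioms.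
-/

open Set
open scoped BigOperators

namespace YMDAG.N18.TwoRunCubes

open Literature.MathematicalPhysics.QuantumFieldTheory.Balaban1983to89
open Literature.MathematicalPhysics.QuantumFieldTheory.Balaban1983to89.T4Continuum
open Literature.MathematicalPhysics.QuantumFieldTheory.Balaban1983to89.T4LevelShift
open Literature.MathematicalPhysics.QuantumFieldTheory.Balaban1983to89.B14DomainGeom (Pt)
open Literature.MathematicalPhysics.QuantumFieldTheory.Balaban1983to89.B14.Eq213MaximalDomains (cubeExt side side_succ)
open Literature.MathematicalPhysics.QuantumFieldTheory.Balaban1983to89.B15Eq112TorusCover (cover)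
open Literature.MathematicalPhysics.QuantumFieldTheory.Balaban1983to89.Node00 (cubeIndices cubeEnl)
open Literature.MathematicalPhysics.QuantumFieldTheory.Balaban1983to89.Node00.W1 (pairOfRecord castDom domSys_succ domCount_succ)
open Literature.MathematicalPhysics.QuantumFieldTheory.Balaban1983to89.Node00.Sect2 (regionOfSet domSys domSites liftIdx cubesI)
open Literature.MathematicalPhysics.QuantumFieldTheory.Balaban1983to89.LatticeFieldCalculus (runSite runBond runSite_zero runSite_succ)
open Literature.MathematicalPhysics.QuantumFieldTheory.Balaban1983to89.TreeLengthTorus (tsys)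

variable (F : T4Family) (k : ℕ)

/-- The ladder of record: run A's finest lattice IS run B's first coarse lattice, `|T_A^{(0)}| = |T_B^{(1)}|` per direction. [cite: Balaban1987RG1, (0.24)-(0.25) p.257] -/
theorem ladder : (F.P k).sitesPerDir 0 = (F.P (k + 1)).sitesPerDir 1 :=
  sitesPerDir_ladder F rfl rfl

/-- Run B's finest level is in the standing range (`0 + 1 ≤ m + (k+1)`). [folklore] -/
theorem standing : 0 + 1 ≤ (F.P (k + 1)).m + (F.P (k + 1)).K := by
  simp only [T4Family.P_m, T4Family.P_K]; omega

/-! ## §1 Blocks of run B's fine sites read on run A; the cubes -/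

/-- `(z mod S) div L ≡ z div L (mod S₁)` for `S = S₁·L`: the block label of a wrapped coordinate is the wrapped block label. [folklore] -/
theorem natCast_val_div_eq_intCast_ediv (S S₁ L : ℕ) [NeZero S] [NeZero S₁] (hS : (S : ℤ) = S₁ * L) (hL : (0 : ℤ) < L) (a : ℤ) :
    (((ZMod.val ((a : ℤ) : ZMod S)) / L : ℕ) : ZMod S₁) = ((a / (L : ℤ) : ℤ) : ZMod S₁) := by
  have hv : ((ZMod.val ((a : ℤ) : ZMod S) : ℕ) : ℤ) = a % S := ZMod.val_intCast a
  have hcast : (((ZMod.val ((a : ℤ) : ZMod S)) / L : ℕ) : ZMod S₁) = ((((ZMod.val ((a : ℤ) : ZMod S)) / L : ℕ) : ℤ) : ZMod S₁) :=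
    (Int.cast_natCast _).symm
  rw [hcast, Int.natCast_div, hv, ZMod.intCast_eq_intCast_iff_dvd_sub, Int.emod_def, hS,
    show a - (S₁ : ℤ) * L * (a / ((S₁ : ℤ) * L)) = a + L * (-((S₁ : ℤ) * (a / ((S₁ : ℤ) * L)))) by ring,
    Int.add_mul_ediv_left _ _ hL.ne']
  exact ⟨a / ((S₁ : ℤ) * L), by ring⟩

/-- ★ **THE BLOCK OF A COVERED POINT IS THE COVERED QUOTIENT POINT**: for every `z ∈ ℤ⁴` (no wrap hypothesis), the block of the run-B fine site `cover z` is, read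
on run A along the ladder, the run-A fine site `cover ⌊z∕L⌋` (coordinatewise floor division). [cite: Balaban1987RG1, (0.1) p.251, (0.24)-(0.25) p.257] -/
theorem blockOf_cover (z : Pt 4) :
    blockOf (cover (F.P (k + 1)) z) = siteShift (ladder F k) (cover (F.P k) fun i => z i / (F.L : ℤ)) := by
  funext μ
  rw [siteShift_apply]
  show (((ZMod.val (((z μ : ℤ)) : ZMod ((F.P (k + 1)).sitesPerDir 0))) / (F.P (k + 1)).L : ℕ) : ZMod ((F.P (k + 1)).sitesPerDir (0 + 1))) =
    coordEquiv (ladder F k) (((z μ / (F.L : ℤ) : ℤ)) : ZMod ((F.P k).sitesPerDir 0))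
  rw [coordEquiv_intCast, T4Family.P_L]
  have hS : (((F.P (k + 1)).sitesPerDir 0 : ℕ) : ℤ) = ((F.P (k + 1)).sitesPerDir (0 + 1) : ℕ) * (F.L : ℤ) := by
    rw [(F.P (k + 1)).sitesPerDir_eq_mul_succ (standing F k), T4Family.P_L]; push_cast; ring
  exact natCast_val_div_eq_intCast_ediv _ _ _ hS (by exact_mod_cast (F.P k).L_pos) _

/-- Two covered points agree iff their coordinates agree modulo the site count. [folklore] -/
theorem cover_eq_cover_iff (P : Params) (z z' : Pt P.d) :
    cover P z = cover P z' ↔ ∀ i, ((P.sitesPerDir 0 : ℕ) : ℤ) ∣ z' i - z i := by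
  constructor
  · intro h i
    have := congrFun h i
    exact (ZMod.intCast_eq_intCast_iff_dvd_sub _ _ _).mp this
  · intro h
    funext i
    exact (ZMod.intCast_eq_intCast_iff_dvd_sub _ _ _).mpr (h i)

/-- Floor division by `L > 0` maps the coordinates of the `L·s`-cube (collar `n·(L·s)`) of index `a` onto those of the `s`-cube (collar `n·s`) of index `a`.
[cite: Balaban1988Convergent, (2.13) pp.256–257 («the partitions are nested»)] -/
theorem ediv_mem_cubeExt_of_mem {d : ℕ} {L : ℕ} (hL : 0 < L) (s : ℕ) (a : Pt d) (n : ℕ) {z : Pt d}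
    (hz : z ∈ cubeExt (L * s) a ((n * (L * s) : ℕ) : ℤ)) : (fun i => z i / (L : ℤ)) ∈ cubeExt s a ((n * s : ℕ) : ℤ) := by
  intro i
  obtain ⟨h1, h2⟩ := hz i
  have hL' : (0 : ℤ) < L := by exact_mod_cast hL
  push_cast at h1 h2 ⊢
  constructor
  · apply Int.le_ediv_of_mul_le hL'
    nlinarith
  · have : z i / (L : ℤ) < ↑s * a i + ↑s + ↑n * ↑s := by
      rw [Int.ediv_lt_iff_lt_mul hL']
      nlinarith
    omega

/-- Conversely, a point whose floor quotient lies in the `s`-cube lies in the `L·s`-cube. [cite: Balaban1988Convergent, (2.13) pp.256–257] -/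
theorem mem_cubeExt_mul_of_ediv_mem {d : ℕ} {L : ℕ} (hL : 0 < L) (s : ℕ) (a : Pt d) (n : ℕ) {z : Pt d}
    (hz : (fun i => z i / (L : ℤ)) ∈ cubeExt s a ((n * s : ℕ) : ℤ)) : z ∈ cubeExt (L * s) a ((n * (L * s) : ℕ) : ℤ) := by
  intro i
  obtain ⟨h1, h2⟩ := hz i
  have hL' : (0 : ℤ) < L := by exact_mod_cast hL
  have hlo : (L : ℤ) * (z i / (L : ℤ)) ≤ z i := Int.mul_ediv_self_le hL'.ne'
  have hhi : z i < (L : ℤ) * (z i / (L : ℤ)) + L := Int.lt_mul_ediv_self_add hL'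
  push_cast at h1 h2 ⊢
  constructor
  · nlinarith
  · nlinarith

/-- ★ **A RUN-B FINE SITE LIES IN THE `L·s`-CUBE OF INDEX `a` IFF ITS BLOCK, READ ON RUN A, LIES IN THE `s`-CUBE OF INDEX `a`** (every `s`, `a`, collar `n`;
origin-anchored cubes `Node00.cubeEnl`, no wrap hypothesis).  The `LM`-cubes of `T_B^{(j+1)}` (`side L M (j+2) = L·side L M (j+1)` run-B fine sites) are thus the
block-preimages of the `LM`-cubes of `T_A^{(j)}`. [cite: Balaban1987RG1, (1.12) p.262, (0.24)-(0.25) p.257] -/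
theorem mem_cubeEnl_succ_iff (s : ℕ) (a : Pt 4) (n : ℕ) (x : Site (F.P (k + 1)) 0) :
    x ∈ cubeEnl (F.P (k + 1)) (F.L * s) a n ↔ (siteShift (ladder F k)).symm (blockOf x) ∈ cubeEnl (F.P k) s a n := by
  have hL : 0 < F.L := (F.P k).L_pos
  have hL' : (F.L : ℤ) ≠ 0 := by exact_mod_cast hL.ne'
  constructor
  · rintro ⟨z, hz, rfl⟩
    rw [blockOf_cover, Equiv.symm_apply_apply]
    exact ⟨fun i => z i / (F.L : ℤ), ediv_mem_cubeExt_of_mem hL s a n hz, rfl⟩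
  · rintro ⟨w, hw, hwx⟩
    -- `hwx : cover_A w = bmap x`; compare with the quotient point of the canonical lift `z₀` of `x`
    set z₀ : Pt 4 := fun i => ((x i).val : ℤ) with hz₀
    have hx : cover (F.P (k + 1)) z₀ = x := by
      funext i
      simp only [cover, hz₀, Int.cast_natCast, ZMod.natCast_zmod_val]
    have hq : cover (F.P k) w = cover (F.P k) (fun i => z₀ i / (F.L : ℤ)) := by
      apply (siteShift (ladder F k)).injective
      rw [← blockOf_cover, hx, hwx, Equiv.apply_symm_apply]
    rw [cover_eq_cover_iff] at hq
    choose t ht using hq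
    -- shift the lift by the multiples `t i` of the run-B site count `S_B = S_A · L`
    have hS : (((F.P (k + 1)).sitesPerDir 0 : ℕ) : ℤ) = ((F.P k).sitesPerDir 0 : ℕ) * (F.L : ℤ) := by
      rw [(F.P (k + 1)).sitesPerDir_eq_mul_succ (standing F k), ← ladder F k, T4Family.P_L]; push_cast; ring
    have hzq : ∀ i : Fin 4, (z₀ i - (((F.P (k + 1)).sitesPerDir 0 : ℕ) : ℤ) * t i) / (F.L : ℤ) = w i := by
      intro i
      rw [hS, show z₀ i - ((F.P k).sitesPerDir 0 : ℕ) * (F.L : ℤ) * t i = z₀ i + (F.L : ℤ) * (-(((F.P k).sitesPerDir 0 : ℕ) : ℤ) * t i) by ring,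
        Int.add_mul_ediv_left _ _ hL']
      linarith [ht i]
    refine ⟨fun i => z₀ i - (((F.P (k + 1)).sitesPerDir 0 : ℕ) : ℤ) * t i, ?_, ?_⟩
    · apply mem_cubeExt_mul_of_ediv_mem hL s a n
      intro i
      have hwi := hw i
      simp only [hzq i]
      exact hwi
    · rw [← hx, cover_eq_cover_iff]
      exact fun i => ⟨t i, by ring⟩

/-- The same, as an identity of site sets: the run-B cube is the block-preimage of the run-A cube. [cite: Balaban1987RG1, (1.12) p.262, (0.24)-(0.25) p.257] -/
theorem cubeEnl_succ_eq_preimage (s : ℕ) (a : Pt 4) (n : ℕ) :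
    cubeEnl (F.P (k + 1)) (F.L * s) a n = (fun x => (siteShift (ladder F k)).symm (blockOf x)) ⁻¹' cubeEnl (F.P k) s a n := by
  ext x
  exact mem_cubeEnl_succ_iff F k s a n x

/-! ## §2 The localization domains: the sites of `π(j, Y)` are the block-preimage of the sites of `Y` -/

/-- Transport of the cube indices along `castDom` between torus catalogues with equal counts does not change the lifted indices. [cite: Balaban1987RG1, p.257 (class 𝐃_j; bookkeeping)] -/
theorem exists_mem_castDom_tsys_iff {n n' : ℕ} [NeZero n] [NeZero n'] (hn : n = n') (h : tsys 4 n = tsys 4 n') (X : (tsys 4 n).Dom)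
    (p : Pt 4 → Prop) :
    (∃ t ∈ (castDom h X).1, p (fun i => ((t i).val : ℤ))) ↔ ∃ t ∈ X.1, p (fun i => ((t i).val : ℤ)) := by
  subst hn
  rfl

/-- **The cube indices of the paired domain `π(j, Y)` are those of `Y`** (same family of `M`-cube indices, [I] (0.24)–(0.25)). [cite: Balaban1987RG1, (0.24)-(0.25) p.257] -/
theorem exists_mem_pairOfRecord_iff (M : ℕ) {j : ℕ} (Y : (domSys (F.P k) M j).Dom) (p : Pt 4 → Prop) :
    (∃ t ∈ (Subtype.val (pairOfRecord F M k ⟨j, Y⟩).2), p (liftIdx (F.P (k + 1)) t)) ↔ ∃ t ∈ Subtype.val Y, p (liftIdx (F.P k) t) :=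
  exists_mem_castDom_tsys_iff (domCount_succ F M k j).symm (domSys_succ F M k j).symm Y p

/-- ★ **THE SITES OF THE PAIRED DOMAIN ARE THE BLOCK-PREIMAGE OF THE SITES OF `Y`**: a run-B fine site lies in `domSites (π(j, Y))` (the union of the `M`-cubes of
`T_B^{(j+1)}` indexed by `Y`'s cube indices) iff its block, read on run A, lies in `domSites Y` (the union of the `M`-cubes of `T_A^{(j)}`).
[cite: Balaban1987RG1, p.257 («X is a union of cubes from π_j»), (0.24)-(0.25) p.257] -/
theorem mem_domSites_pairOfRecord_iff (M : ℕ) {j : ℕ} (Y : (domSys (F.P k) M j).Dom) (x : Site (F.P (k + 1)) 0) :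
    x ∈ domSites (F.P (k + 1)) M (j + 1) (pairOfRecord F M k ⟨j, Y⟩).2 ↔
      (siteShift (ladder F k)).symm (blockOf x) ∈ domSites (F.P k) M j Y := by
  rw [domSites, domSites, Set.mem_iUnion₂, Set.mem_iUnion₂]
  simp only [T4Family.P_L, side_succ, mem_cubeEnl_succ_iff, exists_prop]
  exact exists_mem_pairOfRecord_iff F k M Y (fun a => (siteShift (ladder F k)).symm (blockOf x) ∈ cubeEnl (F.P k) (side F.L M j) a 0)

/-- The same, as an identity of site sets. [cite: Balaban1987RG1, p.257, (0.24)-(0.25) p.257] -/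
theorem domSites_pairOfRecord_eq_preimage (M : ℕ) {j : ℕ} (Y : (domSys (F.P k) M j).Dom) :
    domSites (F.P (k + 1)) M (j + 1) (pairOfRecord F M k ⟨j, Y⟩).2 = (fun x => (siteShift (ladder F k)).symm (blockOf x)) ⁻¹' domSites (F.P k) M j Y := by
  ext x
  exact mem_domSites_pairOfRecord_iff F k M Y x

/-- **The (I.1.12) cube-regions correspond**: the run-B cube of `cubesI M (j+1)` of index `a` intersected with the sites of `π(j, Y)` is the block-preimage of the run-A
cube of `cubesI M j` of index `a` intersected with the sites of `Y` (`side L M (j+2) = L · side L M (j+1)`). [cite: Balaban1987RG1, (1.12) p.262, (0.24)-(0.25) p.257] -/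
theorem cubeInter_succ_eq_preimage (M : ℕ) {j : ℕ} (Y : (domSys (F.P k) M j).Dom) (a : Pt 4) :
    cubeEnl (F.P (k + 1)) (side (F.P (k + 1)).L M (j + 1 + 1)) a 0 ∩ domSites (F.P (k + 1)) M (j + 1) (pairOfRecord F M k ⟨j, Y⟩).2 =
      (fun x => (siteShift (ladder F k)).symm (blockOf x)) ⁻¹' (cubeEnl (F.P k) (side (F.P k).L M (j + 1)) a 0 ∩ domSites (F.P k) M j Y) := by
  rw [Set.preimage_inter, ← cubeEnl_succ_eq_preimage, ← domSites_pairOfRecord_eq_preimage, T4Family.P_L, T4Family.P_L, side_succ]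

/-- `⌈(L·S)∕(L·s)⌉ = ⌈S∕s⌉`: the run-B cube indices of side `L·s` are the run-A cube indices of side `s`. [folklore] -/
theorem cubeIndices_succ_eq (s : ℕ) : cubeIndices (F.P (k + 1)) (F.L * s) = cubeIndices (F.P k) s := by
  have hL : 0 < F.L := (F.P k).L_pos
  have hS : (F.P (k + 1)).sitesPerDir 0 = (F.P k).sitesPerDir 0 * F.L := by
    rw [(F.P (k + 1)).sitesPerDir_eq_mul_succ (standing F k), ← ladder F k, T4Family.P_L]
  have hq : ((F.P (k + 1)).sitesPerDir 0 + F.L * s - 1) / (F.L * s) = ((F.P k).sitesPerDir 0 + s - 1) / s := by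
    rcases Nat.eq_zero_or_pos s with hs | hs
    · subst hs; simp
    · have hLs : 0 < F.L * s := Nat.mul_pos hL hs
      have key : ∀ n, n < ((F.P (k + 1)).sitesPerDir 0 + F.L * s - 1) / (F.L * s) ↔ n < ((F.P k).sitesPerDir 0 + s - 1) / s := by
        intro n
        rw [CondILevelNesting.lt_ceilDiv_iff_mul_lt hLs, CondILevelNesting.lt_ceilDiv_iff_mul_lt hs, hS]
        constructor
        · intro h; nlinarith
        · intro h; nlinarith
      exact le_antisymm (Nat.le_of_not_lt fun h => (lt_irrefl _) ((key _).mp h)) (Nat.le_of_not_lt fun h => (lt_irrefl _) ((key _).mpr h))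
  unfold cubeIndices
  rw [hq]
  rfl

/-- A run-A fine site read as a block of run B: the fine site `emb (siteShift y)` of run B has block `y`. [cite: Balaban1987RG1, (0.3) p.252 (bookkeeping)] -/
theorem bmap_emb (y : Site (F.P k) 0) : (siteShift (ladder F k)).symm (blockOf (emb (siteShift (ladder F k) y))) = y := by
  rw [Site.blockOf_emb (standing F k), Equiv.symm_apply_apply]

/-- The block-preimage of a run-A site set is non-empty iff the set is. [folklore] -/
theorem preimage_bmap_nonempty_iff (Z : Set (Site (F.P k) 0)) :
    ((fun x => (siteShift (ladder F k)).symm (blockOf x)) ⁻¹' Z).Nonempty ↔ Z.Nonempty := by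
  constructor
  · rintro ⟨x, hx⟩; exact ⟨_, hx⟩
  · rintro ⟨y, hy⟩
    refine ⟨emb (siteShift (ladder F k) y), ?_⟩
    show (siteShift (ladder F k)).symm (blockOf (emb (siteShift (ladder F k) y))) ∈ Z
    rw [bmap_emb]; exact hy

/-- ★ **THE RUN-B CUBE-REGION OVER A RUN-A (I.1.12) CUBE-REGION IS ONE OF RUN B'S (I.1.12) CUBE-REGIONS AT THE PAIRED DOMAIN**: for a cube index `a` of
`cubesI M j` (side `L^{j+1}M`) whose cube meets the sites of `Y`, the region of the block-preimage of `□_A ∩ Y_A` is the member of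
`Sect2.cubesI M (j+1) (domSites (π(j, Y)))` of the same index — so run B's condition (1.12) at the table `(j+1, π(j, Y))` supplies a local gauge on exactly the
fine sites feeding `□_A ∩ Y_A`. [cite: Balaban1987RG1, (1.12) p.262, (0.24)-(0.25) p.257] -/
theorem regionOfSet_preimage_mem_cubesI_succ (M : ℕ) {j : ℕ} (Y : (domSys (F.P k) M j).Dom) {a : Pt 4}
    (ha : a ∈ cubeIndices (F.P k) (side (F.P k).L M (j + 1)))
    (hne : (cubeEnl (F.P k) (side (F.P k).L M (j + 1)) a 0 ∩ domSites (F.P k) M j Y).Nonempty) :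
    regionOfSet (F.P (k + 1)) ((fun x => (siteShift (ladder F k)).symm (blockOf x)) ⁻¹'
        (cubeEnl (F.P k) (side (F.P k).L M (j + 1)) a 0 ∩ domSites (F.P k) M j Y)) ∈
      cubesI (P := F.P (k + 1)) M (j + 1) (domSites (F.P (k + 1)) M (j + 1) (pairOfRecord F M k ⟨j, Y⟩).2) := by
  refine ⟨a, ?_, ?_, ?_⟩
  · rw [T4Family.P_L, side_succ, cubeIndices_succ_eq]; rwa [T4Family.P_L] at ha
  · rw [cubeInter_succ_eq_preimage, preimage_bmap_nonempty_iff]; exact hne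
  · rw [cubeInter_succ_eq_preimage]

/-! ## §3 Region faces: the feeding bonds ∕ stencils of a run-A region are bonds ∕ stencils of its block-preimage -/

section Feeding

variable {F k}

/-- Lattice translations commute. [folklore] -/
private theorem shift_comm' {P : Params} {i : ℕ} (x : Site P i) (μ ν : Fin P.d) : (x.shift μ).shift ν = (x.shift ν).shift μ := by
  unfold Site.shift
  by_cases h : ν = μ
  · subst h; rfl
  · rw [Function.update_of_ne h, Function.update_of_ne (Ne.symm h), Function.update_comm h]

/-- `(x + s e_ν) + e_μ = (x + e_μ) + s e_ν`. [folklore] -/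
private theorem shift_runSite {P : Params} {i : ℕ} (x : Site P i) (μ ν : Fin P.d) (s : ℕ) :
    (runSite x ν s).shift μ = runSite (x.shift μ) ν s := by
  have h1 : ∀ z : Site P i, z.shift μ = runSite z μ 1 := fun z => by rw [runSite_succ, runSite_zero]
  rw [h1, h1 x, CondIKRow.runSite_runSite_comm x ν μ s 1]

/-- **A straight run of at most `L` steps moves the block by at most one coarse step**: `blockOf (x + s e_ν) ∈ {blockOf x, blockOf x + e_ν}` for `s ≤ L`
(standing range). [cite: Balaban1984PropagatorsI, (1.8) p.19] -/
theorem blockOf_runSite_or {P : Params} {i : ℕ} (hi : i + 1 ≤ P.m + P.K) (x : Site P i) (ν : Fin P.d) {s : ℕ} (hs : s ≤ P.L) :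
    blockOf (runSite x ν s) = blockOf x ∨ blockOf (runSite x ν s) = (blockOf x).shift ν := by
  have hx : Site.blockSite (blockOf x) (Site.blockEquiv hi (blockOf x) ⟨x, rfl⟩) = x :=
    congrArg Subtype.val ((Site.blockEquiv hi (blockOf x)).symm_apply_apply ⟨x, rfl⟩)
  have key := B5AveragingLocalityV1.blockOf_runSite_blockSite_or hi (blockOf x) (Site.blockEquiv hi (blockOf x) ⟨x, rfl⟩) ν hs
  rwa [hx] at key

/-- **The feeding sites of a coarse stencil lie in the blocks of its four corners**: for `t, s ≤ L`,
`blockOf (blockSite y r + t e_μ + s e_ν) ∈ {y, y + e_μ, y + e_ν, y + e_μ + e_ν}` (standing range). [cite: Balaban1984PropagatorsI, (1.8) p.19] -/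
theorem blockOf_runSite_runSite_mem {P : Params} {i : ℕ} (hi : i + 1 ≤ P.m + P.K) (y : Site P (i + 1)) (r : Fin P.d → Fin P.L) (μ ν : Fin P.d)
    {t s : ℕ} (ht : t ≤ P.L) (hs : s ≤ P.L) :
    blockOf (runSite (runSite (Site.blockSite y r) μ t) ν s) = y ∨ blockOf (runSite (runSite (Site.blockSite y r) μ t) ν s) = y.shift μ ∨
      blockOf (runSite (runSite (Site.blockSite y r) μ t) ν s) = y.shift ν ∨
        blockOf (runSite (runSite (Site.blockSite y r) μ t) ν s) = (y.shift μ).shift ν := by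
  rcases blockOf_runSite_or hi (runSite (Site.blockSite y r) μ t) ν hs with h | h <;>
    rcases B5AveragingLocalityV1.blockOf_runSite_blockSite_or hi y r μ ht with h' | h' <;> rw [h, h']
  · exact Or.inl rfl
  · exact Or.inr (Or.inl rfl)
  · exact Or.inr (Or.inr (Or.inl rfl))
  · exact Or.inr (Or.inr (Or.inr rfl))

/-- **The fine block over a site of `Z` lies in the block-preimage of `Z`.** [cite: Balaban1987RG1, (0.3) p.252 (bookkeeping)] -/
theorem blockSite_mem_preimage (Z : Set (Site (F.P k) 0)) {y : Site (F.P k) 0} (hy : y ∈ Z) (r : Fin 4 → Fin F.L) :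
    Site.blockSite (siteShift (ladder F k) y) r ∈ (fun x => (siteShift (ladder F k)).symm (blockOf x)) ⁻¹' Z := by
  show (siteShift (ladder F k)).symm (blockOf (Site.blockSite (siteShift (ladder F k) y) r)) ∈ Z
  rw [Site.blockOf_blockSite (standing F k), Equiv.symm_apply_apply]
  exact hy

/-- ★ **THE `L^{d+1}` FEEDING BONDS OF A COARSE BOND OF `regionOfSet Z` ARE BONDS OF `regionOfSet (bmap ⁻¹' Z)`** (the locality hypothesis of 19a's
`norm_bondAvg_le_of_forall_run`, discharged): for `⟨y, y + e_μ⟩ ⊂ Z`, `r ∈ {0,…,L−1}⁴`, `t < L`, both endpoints of `runBond (blockSite y_B r) μ t` have their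
blocks in `{y, y + e_μ} ⊂ Z`. [cite: Balaban1984PropagatorsI, (1.11) p.19; Balaban1987RG1, (1.12) p.262] -/
theorem runBond_blockSite_mem_bonds_preimage (Z : Set (Site (F.P k) 0)) {y : Site (F.P k) 0} {μ : Fin 4}
    (hb : (⟨y, μ⟩ : PBond (F.P k) 0) ∈ (regionOfSet (F.P k) Z).bonds) (r : Fin 4 → Fin F.L) {t : ℕ} (ht : t < F.L) :
    runBond (Site.blockSite (siteShift (ladder F k) y) r) μ t ∈
      (regionOfSet (F.P (k + 1)) ((fun x => (siteShift (ladder F k)).symm (blockOf x)) ⁻¹' Z)).bonds := by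
  obtain ⟨hy, hyμ⟩ := hb
  have hyμ' : y.shift μ ∈ Z := hyμ
  have hloc := B5AveragingLocalityV1.runBond_blockSite_local (standing F k) (⟨siteShift (ladder F k) y, μ⟩ : PBond (F.P (k + 1)) 1) r ht
  have htgt : (⟨siteShift (ladder F k) y, μ⟩ : PBond (F.P (k + 1)) 1).tgt = siteShift (ladder F k) (y.shift μ) := by
    show (siteShift (ladder F k) y).shift μ = _; rw [siteShift_shift]
  simp only [htgt] at hloc
  refine ⟨?_, ?_⟩
  · show (siteShift (ladder F k)).symm (blockOf (runBond (Site.blockSite (siteShift (ladder F k) y) r) μ t).src) ∈ Z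
    rcases hloc.1 with h | h <;> rw [h, Equiv.symm_apply_apply]
    exacts [hy, hyμ']
  · show (siteShift (ladder F k)).symm (blockOf (runBond (Site.blockSite (siteShift (ladder F k) y) r) μ t).tgt) ∈ Z
    rcases hloc.2 with h | h <;> rw [h, Equiv.symm_apply_apply]
    exacts [hy, hyμ']

/-- ★ **THE `L^{d+2}` FEEDING STENCILS OF A COARSE STENCIL OF `regionOfSet Z` ARE STENCILS OF `regionOfSet (bmap ⁻¹' Z)`** (the locality hypothesis of 19a's
`norm_bondAvg_shift_sub_le_of_forall_run`, discharged): for the stencil `(y, ν, μ)` of `regionOfSet Z` (corners `y, y+e_ν, y+e_μ, y+e_ν+e_μ ∈ Z`), `r`,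
`t, s < L`, the fine stencil `(blockSite y_B r + t e_μ + s e_ν, ν, μ)` has its four corners in blocks over those four corners.
[cite: Balaban1984PropagatorsI, (1.8) p.19; Balaban1987RG1, (1.12) p.262] -/
theorem feedSite_mem_dpairs_preimage (Z : Set (Site (F.P k) 0)) {y : Site (F.P k) 0} {ν μ : Fin 4}
    (hq : (y, ν, μ) ∈ (regionOfSet (F.P k) Z).dpairs) (r : Fin 4 → Fin F.L) {t s : ℕ} (ht : t < F.L) (hs : s < F.L) :
    (runSite (runSite (Site.blockSite (siteShift (ladder F k) y) r) μ t) ν s, ν, μ) ∈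
      (regionOfSet (F.P (k + 1)) ((fun x => (siteShift (ladder F k)).symm (blockOf x)) ⁻¹' Z)).dpairs := by
  obtain ⟨h0, hν, hμ, hνμ⟩ := hq
  have h0' : y ∈ Z := h0
  have hν' : y.shift ν ∈ Z := hν
  have hμ' : y.shift μ ∈ Z := hμ
  have hνμ' : (y.shift ν).shift μ ∈ Z := hνμ
  set yB := siteShift (ladder F k) y with hyB
  -- every point of the form `blockSite yB r + t' e_μ + s' e_ν`, `t', s' ≤ L`, has its block over a corner of the stencil
  have corner : ∀ {t' s' : ℕ}, t' ≤ F.L → s' ≤ F.L →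
      (siteShift (ladder F k)).symm (blockOf (runSite (runSite (Site.blockSite yB r) μ t') ν s')) ∈ Z := by
    intro t' s' ht' hs'
    rcases blockOf_runSite_runSite_mem (standing F k) yB r μ ν ht' hs' with h | h | h | h <;> rw [h, hyB]
    · rw [Equiv.symm_apply_apply]; exact h0'
    · rw [← siteShift_shift, Equiv.symm_apply_apply]; exact hμ'
    · rw [← siteShift_shift, Equiv.symm_apply_apply]; exact hν'
    · rw [← siteShift_shift, ← siteShift_shift, Equiv.symm_apply_apply, shift_comm']; exact hνμ'
  refine ⟨corner ht.le hs.le, ?_, ?_, ?_⟩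
  · -- `w + e_ν = blockSite yB r + t e_μ + (s+1) e_ν`
    show (siteShift (ladder F k)).symm (blockOf ((runSite (runSite (Site.blockSite yB r) μ t) ν s).shift ν)) ∈ Z
    rw [← runSite_succ]
    exact corner ht.le hs
  · -- `w + e_μ = blockSite yB r + (t+1) e_μ + s e_ν`
    show (siteShift (ladder F k)).symm (blockOf ((runSite (runSite (Site.blockSite yB r) μ t) ν s).shift μ)) ∈ Z
    rw [shift_runSite, ← runSite_succ]
    exact corner ht hs.le
  · -- `w + e_ν + e_μ = blockSite yB r + (t+1) e_μ + (s+1) e_ν`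
    show (siteShift (ladder F k)).symm (blockOf (((runSite (runSite (Site.blockSite yB r) μ t) ν s).shift ν).shift μ)) ∈ Z
    rw [← runSite_succ, shift_runSite, ← runSite_succ]
    exact corner ht hs

end Feeding

end YMDAG.N18.TwoRunCubes
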